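import Mathlib
import Summits.Ventures.PercRepro2.Defs
import Summits.Ventures.PercRepro2.Independence
import Summits.Ventures.PercRepro2.Harris

/-!
# The three-event covariance inequality: reduction to the fibre of the closed edges (blind cell
PercRepro2, p4 g32; proofs/P4-G32-STRUCTURE.md §1 (R-T); S3 (G4-u) item (ap))

For increasing `G, H, M` and an event `B` contained in `allClosed F` (every edge of `F` is closed on
`B`), the inequality `Cov(M, B ∩ H) ≤ Cov(G, H)` for ALL admissible weights `p` follows from the same
inequality for the weights PINNED CLOSED on `F` (`p e = 0` for `e ∈ F`) — i.e. from the inequality on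
the fibre `{ω ∣ ω = 0 on F}` with the edges of `F` removed. The three-event lemma
`Cov(↑(G ∩ B), B ∩ H) ≤ Cov(G, H)` is therefore invariant under adding edges that are closed on `B`.

**`cov_inter_le_cov_of_pinned`**: pinning one edge `e ∈ F` at a time (`prob_eq_pin`):
`Cov_p(G, H) = a·Cov_{p[e↦1]} + (1 − a)·Cov_{p[e↦0]} + a(1 − a)·ΔG·ΔH ≥ (1 − a)·Cov_{p[e↦0]}(G, H)`
(Harris at `p[e↦1]` and monotonicity of `G`, `H`), while
`Cov_p(M, B ∩ H) = (1 − a)·Cov_{p[e↦0]}(M, B ∩ H) − a(1 − a)·ΔM·P_{p[e↦0]}(B ∩ H) ≤ (1 − a)·Cov_{p[e↦0]}(M, B ∩ H)`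
because `B ∩ H` is null under `p[e↦1]` and `M` is increasing. No definition, no instance, no notation.
-/

namespace Summit.Ventures.PercRepro2

namespace ThreeEvent

section Pinning

variable {E : Type*} [Fintype E] [DecidableEq E] {R : Type*} [CommRing R]

omit [Fintype E] [DecidableEq E] in
/-- `allClosed F ⊆ closedEdge e` for `e ∈ F`. -/
lemma allClosed_subset_closedEdge {F : Finset E} {e : E} (he : e ∈ F) :
    allClosed F ⊆ closedEdge e := fun _ hω => (mem_allClosed.1 hω) e he

/-- An event inside `allClosed F` is null once an edge of `F` is pinned open. -/
lemma prob_update_one_of_subset_allClosed (p : E → R) {F : Finset E} {A : Set (Config E)}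
    (hA : A ⊆ allClosed F) {e : E} (he : e ∈ F) :
    prob (Function.update p e 1) A = 0 := by
  have h : A ∩ closedEdge e = A := Set.inter_eq_left.2 ((allClosed_subset_closedEdge he).trans' hA)
  rw [← h]
  exact prob_update_one_inter_closedEdge p A e

/-- An event inside `allClosed F` has `P_p(A) = (1 − p e) · P_{p[e↦0]}(A)` for `e ∈ F`. -/
lemma prob_eq_pin_zero_of_subset_allClosed (p : E → R) {F : Finset E} {A : Set (Config E)}
    (hA : A ⊆ allClosed F) {e : E} (he : e ∈ F) :
    prob p A = (1 - p e) * prob (Function.update p e 0) A := by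
  rw [prob_eq_pin p A e, prob_update_one_of_subset_allClosed p hA he, mul_zero, zero_add]

/-- The covariance `P(X ∩ Y) − P(X) P(Y)`, pinned at an edge. -/
lemma cov_eq_pin' (p : E → R) (X Y : Set (Config E)) (e : E) :
    prob p (X ∩ Y) - prob p X * prob p Y =
      p e * (prob (Function.update p e 1) (X ∩ Y)
          - prob (Function.update p e 1) X * prob (Function.update p e 1) Y)
      + (1 - p e) * (prob (Function.update p e 0) (X ∩ Y)
          - prob (Function.update p e 0) X * prob (Function.update p e 0) Y)
      + p e * (1 - p e) * ((prob (Function.update p e 1) X - prob (Function.update p e 0) X)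
          * (prob (Function.update p e 1) Y - prob (Function.update p e 0) Y)) := by
  rw [prob_eq_pin p (X ∩ Y) e, prob_eq_pin p X e, prob_eq_pin p Y e]
  ring

end Pinning

section Main

variable {E : Type*} [Fintype E] [DecidableEq E] {R : Type*} [CommRing R] [LinearOrder R]
  [IsStrictOrderedRing R]

/-- For an increasing event, pinning an edge open dominates pinning it closed. -/
lemma prob_update_zero_le_prob_update_one' {p : E → R} (hp : IsProbVec p) {A : Set (Config E)}
    (hA : IsUpperSet A) (e : E) :
    prob (Function.update p e 0) A ≤ prob (Function.update p e 1) A := by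
  rw [prob_eq_expect_indicator, prob_eq_expect_indicator]
  exact expect_update_zero_le_expect_update_one hp (monotone_indicator_of_isUpperSet hA) e

/-- **One pinning step**: for `e ∈ F`, `B ⊆ allClosed F`, and increasing `G, H, M`,
`Cov_p(M, B ∩ H) ≤ (1 − p e) · Cov_{p[e↦0]}(M, B ∩ H)` and
`(1 − p e) · Cov_{p[e↦0]}(G, H) ≤ Cov_p(G, H)`. -/
lemma pin_step {p : E → R} (hp : IsProbVec p) {F : Finset E} {G H M B : Set (Config E)}
    (hG : IsUpperSet G) (hH : IsUpperSet H) (hM : IsUpperSet M) (hB : B ⊆ allClosed F)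
    {e : E} (he : e ∈ F) :
    prob p (M ∩ (B ∩ H)) - prob p M * prob p (B ∩ H)
        ≤ (1 - p e) * (prob (Function.update p e 0) (M ∩ (B ∩ H))
            - prob (Function.update p e 0) M * prob (Function.update p e 0) (B ∩ H)) ∧
      (1 - p e) * (prob (Function.update p e 0) (G ∩ H)
            - prob (Function.update p e 0) G * prob (Function.update p e 0) H)
        ≤ prob p (G ∩ H) - prob p G * prob p H := by
  set p₀ := Function.update p e 0 with hp₀
  set p₁ := Function.update p e 1 with hp₁
  have hp1' : IsProbVec p₁ := hp.update e zero_le_one le_rfl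
  have ha0 : 0 ≤ p e := hp.nonneg e
  have ha1 : 0 ≤ 1 - p e := sub_nonneg.2 (hp.le_one e)
  constructor
  · -- the `B ∩ H` side: null under `p₁`
    have hBH : B ∩ H ⊆ allClosed F := Set.inter_subset_left.trans hB
    have hMBH : M ∩ (B ∩ H) ⊆ allClosed F := Set.inter_subset_right.trans hBH
    have h1 : prob p₁ (B ∩ H) = 0 := prob_update_one_of_subset_allClosed p hBH he
    have h2 : prob p₁ (M ∩ (B ∩ H)) = 0 := prob_update_one_of_subset_allClosed p hMBH he
    have hdM : 0 ≤ prob p₁ M - prob p₀ M :=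
      sub_nonneg.2 (prob_update_zero_le_prob_update_one' hp hM e)
    have hBH0 : 0 ≤ prob p₀ (B ∩ H) := prob_nonneg (hp.update e le_rfl zero_le_one) _
    rw [cov_eq_pin' p M (B ∩ H) e, h1, h2]
    have : 0 ≤ p e * (1 - p e) * ((prob p₁ M - prob p₀ M) * prob p₀ (B ∩ H)) :=
      mul_nonneg (mul_nonneg ha0 ha1) (mul_nonneg hdM hBH0)
    nlinarith [this]
  · -- the `G, H` side: Harris at `p₁` and monotonicity
    have hharris : 0 ≤ prob p₁ (G ∩ H) - prob p₁ G * prob p₁ H :=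
      sub_nonneg.2 (prob_mul_prob_le_prob_inter hp1' hG hH)
    have hdG : 0 ≤ prob p₁ G - prob p₀ G :=
      sub_nonneg.2 (prob_update_zero_le_prob_update_one' hp hG e)
    have hdH : 0 ≤ prob p₁ H - prob p₀ H :=
      sub_nonneg.2 (prob_update_zero_le_prob_update_one' hp hH e)
    rw [cov_eq_pin' p G H e]
    have h1 : 0 ≤ p e * (prob p₁ (G ∩ H) - prob p₁ G * prob p₁ H) := mul_nonneg ha0 hharris
    have h2 : 0 ≤ p e * (1 - p e) * ((prob p₁ G - prob p₀ G) * (prob p₁ H - prob p₀ H)) :=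
      mul_nonneg (mul_nonneg ha0 ha1) (mul_nonneg hdG hdH)
    linarith

/-- **Reduction to the closed fibre, inductive form**: with the edges of `F ∖ S` already pinned
closed, `Cov_p(M, B ∩ H) ≤ Cov_p(G, H)` follows from the pinned case. -/
theorem cov_inter_le_cov_of_pinned_aux (F : Finset E) {G H M B : Set (Config E)}
    (hG : IsUpperSet G) (hH : IsUpperSet H) (hM : IsUpperSet M) (hB : B ⊆ allClosed F)
    (hbase : ∀ q : E → R, IsProbVec q → (∀ e ∈ F, q e = 0) →
      prob q (M ∩ (B ∩ H)) - prob q M * prob q (B ∩ H) ≤ prob q (G ∩ H) - prob q G * prob q H)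
    (S : Finset E) :
    S ⊆ F → ∀ p : E → R, IsProbVec p → (∀ e ∈ F, e ∉ S → p e = 0) →
      prob p (M ∩ (B ∩ H)) - prob p M * prob p (B ∩ H) ≤ prob p (G ∩ H) - prob p G * prob p H := by
  classical
  induction S using Finset.induction_on with
  | empty =>
    intro _ p hp hp0
    exact hbase p hp fun e he => hp0 e he (Finset.notMem_empty e)
  | insert e S' heS' ih =>
    intro hSF p hp hp0
    have heF : e ∈ F := hSF (Finset.mem_insert_self e S')
    have hS'F : S' ⊆ F := fun x hx => hSF (Finset.mem_insert_of_mem hx)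
    set p₀ := Function.update p e 0 with hp₀
    have hp0' : IsProbVec p₀ := hp.update e le_rfl zero_le_one
    have hpin₀ : ∀ e' ∈ F, e' ∉ S' → p₀ e' = 0 := by
      intro e' he' hne
      by_cases h : e' = e
      · rw [h, hp₀, Function.update_self]
      · rw [hp₀, Function.update_of_ne h]
        exact hp0 e' he' fun hmem => (Finset.mem_insert.1 hmem).elim h hne
    have hIH := ih hS'F p₀ hp0' hpin₀
    obtain ⟨hleft, hright⟩ := pin_step hp hG hH hM hB heF
    have ha1 : 0 ≤ 1 - p e := sub_nonneg.2 (hp.le_one e)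
    calc prob p (M ∩ (B ∩ H)) - prob p M * prob p (B ∩ H)
        ≤ (1 - p e) * (prob p₀ (M ∩ (B ∩ H)) - prob p₀ M * prob p₀ (B ∩ H)) := hleft
      _ ≤ (1 - p e) * (prob p₀ (G ∩ H) - prob p₀ G * prob p₀ H) :=
          mul_le_mul_of_nonneg_left hIH ha1
      _ ≤ prob p (G ∩ H) - prob p G * prob p H := hright

/-- **Reduction to the closed fibre**: for increasing `G, H, M` and `B ⊆ allClosed F`, if
`Cov_q(M, B ∩ H) ≤ Cov_q(G, H)` holds for every admissible `q` pinned closed on `F`, then it holds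
for every admissible `p`. (Theorem A of P4-G32-STRUCTURE.md is the case `B = allClosed F`,
`M = ↑(G ∩ B)`, where the pinned case is an identity.) -/
theorem cov_inter_le_cov_of_pinned (F : Finset E) {G H M B : Set (Config E)}
    (hG : IsUpperSet G) (hH : IsUpperSet H) (hM : IsUpperSet M) (hB : B ⊆ allClosed F)
    (hbase : ∀ q : E → R, IsProbVec q → (∀ e ∈ F, q e = 0) →
      prob q (M ∩ (B ∩ H)) - prob q M * prob q (B ∩ H) ≤ prob q (G ∩ H) - prob q G * prob q H)
    {p : E → R} (hp : IsProbVec p) :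
    prob p (M ∩ (B ∩ H)) - prob p M * prob p (B ∩ H) ≤ prob p (G ∩ H) - prob p G * prob p H :=
  cov_inter_le_cov_of_pinned_aux F hG hH hM hB hbase F le_rfl p hp fun _ he hne => (hne he).elim

end Main

end ThreeEvent

end Summit.Ventures.PercRepro2
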